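import Mathlib
import HarnessLib

/-!
# Taylor enclosures with a set-valued remainder (interval Taylor form of an ODE solution)

Topic `Literature/Analysis/ODE`. The enclosure behind the *K-th order Taylor step* of validated
ODE integration (Moore 1979, §8.1, eq. (8.10); iterated in the a priori / tight-enclosure pair of
every interval Taylor-series integrator): if a function `y` on `[0, h]` is `k` times
differentiable, with derivative chain `D 0 = y, D 1 = y', …, D k = y⁽ᵏ⁾`, and the top
derivative stays in a closed convex set, `D k s ∈ C` for all `s ∈ [0, h]`, then for every
`t ∈ [0, h]`

  `y t ∈ ∑_{m<k} (t^m / m!) • D m 0 + (t^k / k!) • C`,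

i.e. the Taylor polynomial at `0` plus the remainder monomial times an element of `C`
(`taylorEnclosure_of_deriv_mem`). In Moore's notation (8.10): `x(t) ∈ ∑_{k<N} (x)_k t^k +
R⁽ᴺ⁾ t^N` whenever the interval `R⁽ᴺ⁾` contains the range of the `N`-th Taylor coefficient of
the solution over an a priori enclosure valid on `[0, t]`; `taylorCoeff_enclosure` is that
normalised form (Taylor coefficients `(m!)⁻¹ • D m 0`, remainder `t^k • v` with `v` in a closed
convex `F ∋ (k!)⁻¹ • D k s`).

Moore states (8.10) componentwise for interval boxes, where it is the Lagrange remainder applied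
to each component. The version here is for an arbitrary closed convex set in a real normed space
and is proved without a Lagrange point: a continuous linear functional reduces it to the scalar
comparison "`ψ⁽ᵏ⁾ ≤ M` with vanishing `(k-1)`-jet at `0` implies `ψ t ≤ M t^k / k!`" (iterated
monotonicity), and the Hahn–Banach separation theorem (`geometric_hahn_banach_closed_point`)
turns the family of scalar inequalities back into membership. For `k = 1` it is the mean value
inclusion used in `Literature/Analysis/ODE/ConstantEnclosure.lean`; for general `k` it is the
soundness of the tight enclosure computed after the constant (a priori) enclosure test: along a
solution of `y' = f(y)` that stays in `S` on `[0, h]` one has `(k!)⁻¹ • y⁽ᵏ⁾(s) = f^[k](y s) ∈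
f^[k](S)`, the `k`-th Taylor coefficient function evaluated over the a priori box.

## References

* R. E. Moore, *Methods and Applications of Interval Analysis*, SIAM Studies in Applied
  Mathematics 2 (SIAM 1979), §8.1, eqs. (8.9)–(8.11). [Moore1979]
* N. S. Nedialkov, K. R. Jackson, G. F. Corliss, *Validated solutions of initial value problems
  for ordinary differential equations*, Appl. Math. Comput. 105 (1999) 21–68, §5 (interval
  Taylor series methods). [NedialkovJacksonCorliss1999]
-/

noncomputable section

open Set Metric

open scoped NNReal Nat Pointwise

namespace Literature.Analysis.ODE

variable {E : Type*} [NormedAddCommGroup E] [NormedSpace ℝ E]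

/-- Scalar comparison: a real derivative chain `ψ 0, ψ 1 = (ψ 0)', …` on `[0, h]` with
`ψ i 0 = 0` for `i < k` and `ψ k ≤ M` satisfies `ψ 0 t ≤ M t^k / k!` (iterated monotonicity).
[folklore] -/
private theorem scalar_taylor_bound :
    ∀ (k : ℕ) (ψ : ℕ → ℝ → ℝ) {h M : ℝ},
      (∀ i < k, ∀ s ∈ Icc 0 h, HasDerivWithinAt (ψ i) (ψ (i + 1) s) (Icc 0 h) s) →
      (∀ i < k, ψ i 0 = 0) → (∀ s ∈ Icc 0 h, ψ k s ≤ M) →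
        ∀ t ∈ Icc 0 h, ψ 0 t ≤ M * t ^ k / (k ! : ℝ) := by
  intro k
  induction k with
  | zero =>
    intro ψ h M _ _ hM t ht
    simpa using hM t ht
  | succ k ih =>
    intro ψ h M hder h0 hM t ht
    have h1 : ∀ s ∈ Icc 0 h, ψ 1 s ≤ M * s ^ k / (k ! : ℝ) :=
      ih (fun i => ψ (i + 1)) (fun i hi s hs => hder (i + 1) (by omega) s hs)
        (fun i hi => h0 (i + 1) (by omega)) (by simpa using hM)
    have hmono : MonotoneOn (fun s => M * s ^ (k + 1) / ((k + 1)! : ℝ) - ψ 0 s) (Icc 0 h) := by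
      refine monotoneOn_of_hasDerivWithinAt_nonneg (convex_Icc 0 h)
        (f' := fun s => M * s ^ k / (k ! : ℝ) - ψ 1 s) ?_ ?_ ?_
      · have hc : ContinuousOn (ψ 0) (Icc 0 h) := fun s hs =>
          (hder 0 (by omega) s hs).continuousWithinAt
        exact (by fun_prop : Continuous fun s : ℝ => M * s ^ (k + 1) / ((k + 1)! : ℝ)).continuousOn.sub
          hc
      · intro s hs
        rw [interior_Icc] at hs
        have hψ : HasDerivWithinAt (ψ 0) (ψ 1 s) (Ioo 0 h) s :=
          (hder 0 (by omega) s (Ioo_subset_Icc_self hs)).mono Ioo_subset_Icc_self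
        have hp : HasDerivAt (fun x : ℝ => M * x ^ (k + 1) / ((k + 1)! : ℝ)) (M * s ^ k / (k ! : ℝ))
            s := by
          refine (((hasDerivAt_pow (k + 1) s).const_mul M).div_const ((k + 1)! : ℝ)).congr_deriv ?_
          rw [Nat.factorial_succ, Nat.add_sub_cancel]
          push_cast
          have hkf : (k ! : ℝ) ≠ 0 := by positivity
          have hk1 : ((k : ℝ) + 1) ≠ 0 := by positivity
          field_simp
        rw [interior_Icc]
        exact hp.hasDerivWithinAt.sub hψ
      · intro s hs
        rw [interior_Icc] at hs
        have := h1 s (Ioo_subset_Icc_self hs)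
        show 0 ≤ M * s ^ k / (k ! : ℝ) - ψ 1 s
        linarith
    have h0h : (0 : ℝ) ∈ Icc 0 h := left_mem_Icc.2 (ht.1.trans ht.2)
    have hle := hmono h0h ht ht.1
    simp only [h0 0 (by omega)] at hle
    have : M * (0 : ℝ) ^ (k + 1) / ((k + 1)! : ℝ) = 0 := by simp
    linarith [hle, this]

/-- The zero-jet case of the Taylor enclosure: a derivative chain `D` on `[0, h]` in a real normed
space with `D i 0 = 0` (`i < k`) and `D k s ∈ C` (`C` closed convex) has
`D 0 t ∈ (t^k / k!) • C`. Hahn–Banach separation + `scalar_taylor_bound`. [folklore] -/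
private theorem taylorEnclosure_zeroJet (k : ℕ) {D : ℕ → ℝ → E} {C : Set E} (hC : Convex ℝ C)
    (hCc : IsClosed C) {h : ℝ}
    (hder : ∀ i < k, ∀ s ∈ Icc 0 h, HasDerivWithinAt (D i) (D (i + 1) s) (Icc 0 h) s)
    (h0 : ∀ i < k, D i 0 = 0) (hk : ∀ s ∈ Icc 0 h, D k s ∈ C) {t : ℝ} (ht : t ∈ Icc 0 h) :
    ∃ c ∈ C, D 0 t = (t ^ k / (k ! : ℝ)) • c := by
  rcases Nat.eq_zero_or_pos k with rfl | hkpos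
  · exact ⟨D 0 t, hk t ht, by simp⟩
  rcases ht.1.eq_or_lt with h0t | htpos
  · subst h0t
    refine ⟨D k 0, hk 0 ht, ?_⟩
    rw [h0 0 hkpos, zero_pow hkpos.ne', zero_div, zero_smul]
  set a : ℝ := t ^ k / (k ! : ℝ) with ha
  have hapos : 0 < a := by positivity
  by_cases hmem : a⁻¹ • D 0 t ∈ C
  · exact ⟨_, hmem, by rw [smul_inv_smul₀ hapos.ne']⟩
  exfalso
  obtain ⟨ℓ, u, hℓC, hℓx⟩ := geometric_hahn_banach_closed_point hC hCc hmem
  have hψ := scalar_taylor_bound k (fun i s => ℓ (D i s)) (h := h) (M := u)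
    (fun i hi s hs => ℓ.hasFDerivAt.comp_hasDerivWithinAt s (hder i hi s hs))
    (fun i hi => by simp [h0 i hi]) (fun s hs => (hℓC _ (hk s hs)).le) t ht
  have hle : ℓ (a⁻¹ • D 0 t) ≤ u := by
    rw [map_smul, smul_eq_mul, inv_mul_le_iff₀ hapos]
    calc ℓ (D 0 t) ≤ u * t ^ k / (k ! : ℝ) := hψ
      _ = a * u := by rw [ha]; ring
  exact absurd hℓx (not_lt.2 hle)

/-- Termwise derivative of a Taylor polynomial `∑_{m ≤ n} (x^m / m!) • c m`: it is the Taylor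
polynomial of the shifted coefficients `∑_{m < n} (x^m / m!) • c (m+1)`. [folklore] -/
private theorem hasDerivAt_taylorPoly (c : ℕ → E) (n : ℕ) (s : ℝ) :
    HasDerivAt (fun x : ℝ => ∑ m ∈ Finset.range (n + 1), (x ^ m / (m ! : ℝ)) • c m)
      (∑ m ∈ Finset.range n, (s ^ m / (m ! : ℝ)) • c (m + 1)) s := by
  have hd : HasDerivAt (fun x : ℝ => ∑ m ∈ Finset.range (n + 1), (x ^ m / (m ! : ℝ)) • c m)
      (∑ m ∈ Finset.range (n + 1), ((m : ℝ) * s ^ (m - 1) / (m ! : ℝ)) • c m) s :=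
    HasDerivAt.fun_sum fun m _ => ((hasDerivAt_pow m s).div_const _).smul_const (c m)
  convert hd using 1
  rw [Finset.sum_range_succ']
  simp only [Nat.cast_zero, zero_mul, zero_div, zero_smul, add_zero]
  refine Finset.sum_congr rfl fun m _ => ?_
  congr 1
  rw [Nat.factorial_succ, Nat.add_sub_cancel]
  push_cast
  have hm : (m ! : ℝ) ≠ 0 := by positivity
  have hm1 : ((m : ℝ) + 1) ≠ 0 := by positivity
  field_simp

/-- **Taylor enclosure with a set-valued remainder (Moore 1979, §8.1, eq. (8.10)).** Let `E` be a
real normed space, `C ⊆ E` closed and convex, and let `D : ℕ → ℝ → E` be a derivative chain of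
length `k` on `[0, h]`: `D (i+1) s` is the derivative of `D i` within `[0, h]` at every
`s ∈ [0, h]`, for `i < k` (so `D 0 = y`, `D i = y⁽ⁱ⁾`). If the top derivative stays in `C`,
`D k s ∈ C` for all `s ∈ [0, h]`, then for every `t ∈ [0, h]` there is `c ∈ C` with

  `D 0 t = ∑_{m<k} (t^m / m!) • D m 0 + (t^k / k!) • c`,

i.e. `y t` lies in the Taylor polynomial of order `k-1` at `0` plus `(t^k/k!) • C`. This is the
interval Taylor form `x(t) ∈ ∑_{k<N} (x)_k t^k + R⁽ᴺ⁾ t^N` of Moore (8.10) (there componentwise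
for boxes; here for any closed convex set, via Hahn–Banach separation and a scalar comparison
argument, no Lagrange point needed). [cite: Moore1979, §8.1 eq. (8.10)] -/
theorem taylorEnclosure_of_deriv_mem (k : ℕ) {D : ℕ → ℝ → E} {C : Set E} (hC : Convex ℝ C)
    (hCc : IsClosed C) {h : ℝ}
    (hder : ∀ i < k, ∀ s ∈ Icc 0 h, HasDerivWithinAt (D i) (D (i + 1) s) (Icc 0 h) s)
    (hk : ∀ s ∈ Icc 0 h, D k s ∈ C) {t : ℝ} (ht : t ∈ Icc 0 h) :
    ∃ c ∈ C, D 0 t = (∑ m ∈ Finset.range k, (t ^ m / (m ! : ℝ)) • D m 0) + (t ^ k / (k ! : ℝ)) • c := by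
  -- the Taylor polynomials of the chain: `P i` is the Taylor polynomial of `D i` at `0`
  set P : ℕ → ℝ → E := fun i s => ∑ m ∈ Finset.range (k - i), (s ^ m / (m ! : ℝ)) • D (i + m) 0
    with hP
  have hPder : ∀ i < k, ∀ s : ℝ, HasDerivAt (P i) (P (i + 1) s) s := by
    intro i hi s
    have hki : k - i = (k - i - 1) + 1 := by omega
    have hd := hasDerivAt_taylorPoly (fun m => D (i + m) 0) (k - i - 1) s
    have hfun : P i =
        fun x : ℝ => ∑ m ∈ Finset.range (k - i - 1 + 1), (x ^ m / (m ! : ℝ)) • D (i + m) 0 := by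
      funext x
      simp only [hP, ← hki]
    have hval :
        P (i + 1) s = ∑ m ∈ Finset.range (k - i - 1), (s ^ m / (m ! : ℝ)) • D (i + (m + 1)) 0 := by
      simp only [hP, show k - (i + 1) = k - i - 1 by omega]
      exact Finset.sum_congr rfl fun m _ => by rw [show i + 1 + m = i + (m + 1) by omega]
    rw [hfun, hval]
    exact hd
  have hP0 : ∀ i < k, P i 0 = D i 0 := by
    intro i hi
    simp only [hP]
    rw [Finset.sum_eq_single 0]
    · simp
    · intro m _ hm
      rw [zero_pow hm, zero_div, zero_smul]
    · intro habs
      exact absurd (Finset.mem_range.2 (by omega : 0 < k - i)) habs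
  have hPk : ∀ s, P k s = 0 := fun s => by simp [hP]
  -- the remainder chain `D i - P i` has vanishing jet at `0` and the same top derivative
  obtain ⟨c, hcC, hc⟩ := taylorEnclosure_zeroJet k (D := fun i s => D i s - P i s) hC hCc (h := h)
    (fun i hi s hs => (hder i hi s hs).sub (hPder i hi s).hasDerivWithinAt)
    (fun i hi => by simp [hP0 i hi]) (fun s hs => by simpa [hPk s] using hk s hs) ht
  refine ⟨c, hcC, ?_⟩
  have hP0t : P 0 t = ∑ m ∈ Finset.range k, (t ^ m / (m ! : ℝ)) • D m 0 := by
    simp only [hP, Nat.sub_zero, zero_add]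
  rw [← hP0t]
  have : D 0 t - P 0 t = (t ^ k / (k ! : ℝ)) • c := hc
  rw [← this]
  abel

/-- **Taylor-coefficient form (Moore 1979, §8.1, eqs. (8.10)–(8.11)).** With the Taylor
coefficients `(y)_m = (m!)⁻¹ • D m 0` of a derivative chain `D` on `[0, h]` and a closed convex
set `F` containing the normalised top derivative `(k!)⁻¹ • D k s` for all `s ∈ [0, h]` (for a
solution of `y' = f(y)` that stays in an a priori enclosure `S` on `[0, h]` this is the `k`-th
Taylor coefficient function `f^[k](y s)`, so any `F ⊇ f^[k](S)` qualifies):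
`y t ∈ ∑_{m<k} t^m • (y)_m + t^k • F` for every `t ∈ [0, h]` — the enclosure a validated interval
Taylor step returns. [cite: Moore1979, §8.1 eqs. (8.10)–(8.11)] -/
theorem taylorCoeff_enclosure (k : ℕ) {D : ℕ → ℝ → E} {F : Set E} (hF : Convex ℝ F)
    (hFc : IsClosed F) {h : ℝ}
    (hder : ∀ i < k, ∀ s ∈ Icc 0 h, HasDerivWithinAt (D i) (D (i + 1) s) (Icc 0 h) s)
    (hk : ∀ s ∈ Icc 0 h, (k ! : ℝ)⁻¹ • D k s ∈ F) {t : ℝ} (ht : t ∈ Icc 0 h) :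
    ∃ v ∈ F, D 0 t = (∑ m ∈ Finset.range k, t ^ m • ((m ! : ℝ)⁻¹ • D m 0)) + t ^ k • v := by
  have hkf : (k ! : ℝ) ≠ 0 := by positivity
  obtain ⟨c, hcC, hc⟩ := taylorEnclosure_of_deriv_mem k (C := (k ! : ℝ) • F) (hF.smul _)
    (hFc.smul_of_ne_zero hkf) hder
    (fun s hs => by
      have := smul_mem_smul_set (a := (k ! : ℝ)) (hk s hs)
      rwa [smul_inv_smul₀ hkf] at this) ht
  obtain ⟨v, hvF, rfl⟩ := mem_smul_set.1 hcC
  refine ⟨v, hvF, ?_⟩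
  rw [hc, smul_smul, div_mul_cancel₀ _ hkf]
  congr 1
  exact Finset.sum_congr rfl fun m _ => by rw [smul_smul, div_eq_mul_inv]

end Literature.Analysis.ODE

end
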